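import Summits.QuantumFields.BalabanUV.T4Continuum.Support.ShellMeasureLiveEndOneCallSlotHistories
import Summits.QuantumFields.BalabanUV.T4Continuum.Support.ShellMeasureHistoriesTransport
import Summits.QuantumFields.BalabanUV.T4Continuum.Support.ShellMeasureRootCompositionHistoriesFine

/-!
# `T4Continuum.ShellMeasureLiveEndOneCallHistoriesFine` — row S103b file 3‴ «THE ONE CALL ON THE HISTORIES ROAD, FINE CURRENCY»: END-II (S99 f3b) per history on the
# slot's OWN layer (KEPT host, S99 f4) ∘ S103a §3c's TRANSPORT ∘ the crew's histories-road END-I OF RECORD S93 §3 (`LocalRate` BY NAME)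
(cell `pub-balaban`, sub-cell `t4`, NE7c (node U5b); crew unit `b2b-balaban-t4-ne7c-formalise-leaf-09` gen 13; owner table row **S103b** (R-ne7cp1-g35-6 (b):
CLAIM journal l.21414); the FINE-CURRENCY TWIN of file 2‴ `ShellMeasureLiveEndOneCallHistories` (which closes with the owner's S90 f3 in threshold
units): imports file 1‴ `ShellMeasureLiveEndOneCallSlotHistories` (S99 f3b ∘ S90 per `(r,K,t,s,τ)`), S103a `ShellMeasureHistoriesTransport` v1.1 (leaf-08-g16: §3c
`hac_histories_fine_of_layers`, XREAD C-ne7cleaf03g8-3's point) and S93 `ShellMeasureRootCompositionHistoriesFine` (leaf-05-g9: §3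
`shellWeightBound_histories_fine_of_localRate` — the histories-road END-I OF RECORD, D-ne7cp1-g33-1) ONLY; [folklore]; 0 `def`, 0 `def … : Prop`,
0 sorry, 0 cite; END-II block generated by `gen103.py` mode `histL`)

HONEST FRAMING.  Finite four-torus programme, rung (B)+1 only — NOT infinite volume, NOT a mass gap, NOT the Clay problem, NOT summit progress; (B),
`BetaPertHyp`, (B^μ) not consumed.  NE7c (`T4IndicatorShell.ShellWeightBound`) is NOT PRINTED in [Balaban 1983–89] and NOT PROVED; «NE7c ⇐ the named
binders» (trigger c3): every binder below is DISPLAYED, asserted by nobody; no estimate of Bałaban's is discharged; `LocalRate` is node U1b's NOT-PRINTED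
output shape, consumed BY NAME (c4).  What this declaration changes is OUR bookkeeping: END-I's (R)+[dict] rows R23d (`T A B shA shB pieceA pieceB MA MB
hFfin sh_nonneg… total_ge…`, class O in the owner's census) are PROVED by the histories road (S24∕S93) instead of displayed; what ENTERS
is the histories structure (`T C small lvl`, the history laws `ν r K t τ` on the common space `Ω K`, END-I's variables `v r K t s`), the LAYER READING maps
`π r K s : Ω K → GaugeField (P r K s) (jl r K s) SU2` with the RAW reading `v = u ∘ π` and the identification `(histLaw …).map π = fieldMeasure.withDensity F`
per history ([O] — node O's dictionary; INHABITABLE by the designed objects because the layer measure is the KEPT one `𝟙{u < ε·η²}·F` —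
leaf-03-g8's N-ne7cleaf03g8-1 ∕ owner R-ne7cp1-g36-7 (b): `ShellMeasureHistoriesTransportKept.map_withDensity_tower_indicator`), `LocalRate` + identities + floor ([N]∕[O]).
HONEST DEPENDENCY (cell): continuum YM on T⁴ ⇐ BetaPertH ∧ nine spine estimates (0/9 proved); BetaPertH ⇐ (D1) ∧ (D4) ∧ CAP+tail; G-an2-4 gates asym,
D1 and NE2/3/4.

WHAT IS PROVED ([folklore]).  **`shellWeightBound_histories_oneCall_fine_cfB7`**: as file 2‴, in S93's FINE currency — file 1‴'s threshold-units (M1) per `(r,K,t,s,τ)` is read back RAW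
(`u` at threshold `ε·η²`, S90 `slotAntiConcentration_fine_iff`), lifted to the level constant by `hDslot`, transported by S103a §3c
`hac_histories_fine_of_layers` (RAW reading `v = u ∘ π`, fine scales `ηr K s := η r (jl r K s)`) to the `s`-small partial laws with the FINE profile
`ε (K − lvl K s)·η r (jl r K s)²`, and closed by S93 §3 `shellWeightBound_histories_fine_of_localRate` (realisation identities for `v∕η²`, floor, window,
`D ≤ D̄`, `LocalRate` BY NAME).  CONCLUSION LITERALLY S93 §3's: `ShellWeightBound l₀ T (histWeight … fine profile) (…) (histShell … of the normalised pairs)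
(…) (fun K => Σ_{s∈C K} D true (lvl K s)·geomWidth … + Σ D false …)`.  (x3‴) as file 2‴.
-/

noncomputable section

open Set Metric NormedSpace MeasureTheory Function Finset
open scoped ENNReal

namespace Summit.QuantumFields.BalabanUV.T4Continuum.ShellMeasureLiveEndOneCallHistoriesFine

open Literature.MathematicalPhysics.QuantumFieldTheory.Balaban1983to89
open B11Prop6Scheme (Prop4Hyp)
open GaugeField (GaugeInvariant)
open T4IndicatorShell (ShellWeightBound)
open T4ShellMeasure (SlotAntiConcentration)
open T4ShellMeasureLevels (LiveWindow)
open T4ShellMeasureFibre (slotAntiConcentration_mono)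
open T4EtaRateMin (Readings LocalRate)
open T4SupCloseLiaison (geomWidth geomWidth_nonneg)
open T4CubePoincare (cube)
open T4CubeChartGnomonic (SU2)
open T4CubeChartExp (expFibreChart)
open T4TreeGaugeFixing (fixTo)
open T4AxialGaugeFixing (combBonds)
open T4AxialGaugeSmallField (boxPlaqs boxBonds)
open T4ShellMeasurePlaquette (expTail₂)
open ShellMeasureLevelAssembly (classifier)
open ShellMeasureMultiGridNorms (WSup)
open ShellMeasureMultiGridNorms.WSup (toPiL)
open ShellMeasurePinnedNorm (pinW)
open ShellMeasureDecayKernelSums (kerOp)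
open ShellMeasureLandauHolonomy (solAt landauExp)
open ShellMeasureLandauHolonomyChart (holOf cplx)
open ShellMeasureLandauHolonomySkew (readOutReal)
open B7Prop2Explicit (C0 c2' unitaryUnits)
open B7Prop1Local (pdevOn loK bondHiK)
open B7Prop5Flat (BondIn)
open ShellMeasureAverageProp4General (O1cov C2cov)
open ShellMeasureLandauCorrectionB7 (landauCf landauRad)
open ShellMeasureLandauCorrectionReal (skewPi)
open ShellMeasureLandauCfBoxLocal (landauCfBox)
open ShellMeasureRootCompositionHistories (histLaw partialLaw histWeight histShell)
open ShellMeasureHistoriesTransport (hac_histories_fine_of_layers)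
open ShellMeasureRootCompositionHistoriesFine (shellWeightBound_histories_fine_of_localRate)
open ShellMeasureThresholdUnits (slotAntiConcentration_fine_iff)
open ShellMeasureLiveEndOneCallSlotHistories (hac_live_of_assembled_decay_histories_cfB7)
open scoped Matrix.Norms.L2Operator

variable {σ ι : Type*} [DecidableEq σ] {n : Type*} [Fintype n] [DecidableEq n] [Nonempty n]

/-- **`ShellWeightBound` ON THE HISTORIES ROAD, FINE CURRENCY ⇐ THE NAMED BINDERS** (row S103b file 3‴; module docstring).  CONDITIONAL on every displayed binder; nothing
PRINTED is asserted; NOT Bałaban's minimiser; `LocalRate` by name; NE7c NOT proved. [folklore] -/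
theorem shellWeightBound_histories_oneCall_fine_cfB7
    -- THE HISTORIES STRUCTURE of the comparison (S24∕S90 f3): common sample spaces `Ω K`, term families `T K`, slots `C K`, live-small slots per
    -- history `small K τ ⊆ C K`, slot levels `lvl K s`; per run `r` the history laws `ν r K t τ` (finite) and END-I's tested variables `v r K t s`
    {Ω : ℕ → Type*} [∀ K, MeasurableSpace (Ω K)] {T : ℕ → Finset ι} {C : ℕ → Finset σ} {small : ℕ → ι → Finset σ} {lvl : ℕ → σ → ℕ}
    {ν : Bool → ∀ K : ℕ, ℝ → ι → Measure (Ω K)} [∀ r K t τ, IsFiniteMeasure (ν r K t τ)] {v : Bool → ∀ K : ℕ, ℝ → σ → Ω K → ℝ}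
    (hv : ∀ r K t s, Measurable (v r K t s)) (hsmall : ∀ K, ∀ τ ∈ T K, small K τ ⊆ C K) {l₀ : ℝ}
    -- THE SLOT LAYERS per run: lattice `(P r K s, jl r K s)`; END-II's profiles `η β` by lattice level, the age threshold `ε`, level constants `D r`
    (P : Bool → ℕ → σ → Params) (jl : Bool → ℕ → σ → ℕ) [∀ r K s, DecidableEq (PBond (P r K s) (jl r K s))]
    {ε : ℕ → ℝ} {η β D : Bool → ℕ → ℝ} (hη : ∀ r j, 0 < η r j) (hε : ∀ a, 0 < ε a) (hD0 : ∀ r j, 0 ≤ D r j)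
    -- node U1b BY NAME (S90 f3's binders VERBATIM): the local rate, the floor on the age profile, the realisation identities, `D ≤ D̄`, the window
    {Dat Sit : Type*} {R : Readings Dat Sit} {Cr ϑ θmin : ℝ} {N₁ : ℕ} {νbar Dbar : ℝ}
    (hloc : LocalRate R Cr ϑ) (hCr : 0 ≤ Cr) (hϑ0 : 0 < ϑ) (hϑ1 : ϑ < 1) (hmin : 0 < θmin) (hfloor : ∀ a ≤ N₁, θmin ≤ ε a)
    (hRA : ∀ K t, |t| ≤ l₀ → ∀ τ ∈ T K, ∀ s ∈ small K τ, ∀ᵐ ω ∂(ν true K t τ), ∃ V ∈ R.dom, ∃ x : Sit,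
      v true K t s ω / η true (jl true K s) ^ 2 = R.loc (lvl K s) V x ∧ v false K t s ω / η false (jl false K s) ^ 2 = R.loc (lvl K s + 1) V x)
    (hRB : ∀ K t, |t| ≤ l₀ → ∀ τ ∈ T K, ∀ s ∈ small K τ, ∀ᵐ ω ∂(ν false K t τ), ∃ V ∈ R.dom, ∃ x : Sit,
      v true K t s ω / η true (jl true K s) ^ 2 = R.loc (lvl K s) V x ∧ v false K t s ω / η false (jl false K s) ^ 2 = R.loc (lvl K s + 1) V x)
    (hw : LiveWindow C lvl N₁ νbar) (hDbar : ∀ r j, D r j ≤ Dbar)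
    -- THE LAYER READING (S103a §3c; [dict] node O — at one averaging step KERNEL under `HaarAC`, S103a §4): measurable maps to the slot's layer, END-I's
    -- RAW variable = END-II's classifier read through them, each history's law (fine profile) pushed to the layer = the KEPT layer measure `𝟙{u < ε·η²}·F … τ`
    (π : ∀ r K s, Ω K → GaugeField (P r K s) (jl r K s) SU2) (hπ : ∀ r K s, Measurable (π r K s))
    -- ══ EVERY END-II binder of S99 f3b as a family: types∕box∕chart by `(r,K,s)`, the classifier side by `(r,K,t,s)`, the DENSITY side by
    -- `(r,K,t,s,τ)` (history-indexed), `κr κc κwb κcb dbar Kw` by lattice level — file 1‴'s list with END-I's `lvl K s`, `ε (K − lvl K s)` ══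
    {𝒴 𝒵 ℬ : Bool → ℕ → σ → Type*} [∀ r K s, NormedAddCommGroup (𝒴 r K s)] [∀ r K s, NormedSpace ℂ (𝒴 r K s)] [∀ r K s, CompleteSpace (𝒴 r K s)]
    [∀ r K s, NormedAddCommGroup (𝒵 r K s)] [∀ r K s, NormedSpace ℂ (𝒵 r K s)] [∀ r K s, NormedAddCommGroup (ℬ r K s)]
    [∀ r K s, NormedSpace ℂ (ℬ r K s)] {𝔸 : Bool → ℕ → σ → Type*} [∀ r K s, CStarAlgebra (𝔸 r K s)] [∀ r K s, Nontrivial (𝔸 r K s)]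
    {lo hi : ∀ r K s, Fin (P r K s).d → ℤ} {nb : Bool → ℕ → σ → ℕ} (hn : ∀ r K s, ∀ κ, hi r K s κ ≤ lo r K s κ + nb r K s)
    (hN : ∀ r K s, ∀ κ, hi r K s κ - lo r K s κ < (P r K s).sitesPerDir (jl r K s)) (Λ : ∀ r K s, Finset (PBond (P r K s) (jl r K s)))
    (hΛbox : ∀ r K s, ∀ b ∈ Λ r K s, b ∈ boxBonds (lo r K s) (hi r K s)) (hΛcomb : ∀ r K s, Disjoint (Λ r K s) (combBonds (lo r K s) (hi r K s)))
    {m₀ : Bool → ℕ → σ → ℕ} (e : ∀ r K s, ↥(Λ r K s) × Fin 3 ≃ Fin (m₀ r K s)) {S : ℝ} (hS : 0 < S) (hSπ : 3 * S ^ 2 < Real.pi ^ 2)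
    {F : ∀ r K (t : ℝ) s (τ : ι), GaugeField (P r K s) (jl r K s) SU2 → ℝ≥0∞} (hF : ∀ r K t s τ, Measurable (F r K t s τ))
    (hFi : ∀ r K t s τ, GaugeInvariant (F r K t s τ)) {u : ∀ r K (t : ℝ) s, GaugeField (P r K s) (jl r K s) SU2 → ℝ}
    (hu : ∀ r K t s, Measurable (u r K t s)) (hui : ∀ r K t s, GaugeInvariant (u r K t s)) {ιc : Bool → ℕ → σ → Type*}
    {Pu : ∀ r K (t : ℝ) s, Finset (ιc r K s)} (hPu : ∀ r K t s, (Pu r K t s).Nonempty)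
    (W : ∀ r K (t : ℝ) s (τ : ι), GaugeField (P r K s) (jl r K s) SU2 → Set (Fin (m₀ r K s) → ℝ))
    (Jco : ∀ r K (t : ℝ) s (τ : ι), GaugeField (P r K s) (jl r K s) SU2 → (Fin (m₀ r K s) → ℝ) → ℝ≥0∞) {δ : ℝ}
    (𝒢 : ∀ r K (t : ℝ) s, GaugeField (P r K s) (jl r K s) SU2 → (𝒵 r K s →L[ℂ] (𝒴 r K s)))
    (W𝒱 : ∀ r K (t : ℝ) s, GaugeField (P r K s) (jl r K s) SU2 → 𝒴 r K s → 𝒵 r K s) {B₀ C₄ a₃ ε₄ : ℝ}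
    (h𝒢 : ∀ r K t s, ∀ V f, ‖𝒢 r K t s V f‖ ≤ B₀ * ‖f‖) (hW : ∀ r K t s, ∀ V, Prop4Hyp (W𝒱 r K t s V) C₄ a₃) (hB₀ : 0 < B₀) (hC₄ : 0 ≤ C₄)
    (hε₄ : 0 ≤ ε₄) {dL C₁ B₃ ε₁ : ℝ} (hdL : 0 ≤ dL) (hC₁ : 0 ≤ C₁) (hε₁ : 0 ≤ ε₁) (hB₃ : dL ≤ B₃) (h1 : 2 * B₀ * C₁ * B₃ * ε₁ ≤ ε₄) (h2 : 4 * ε₄ ≤ a₃)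
    (h3 : 16 * B₀ * C₄ * ε₄ ≤ 1) (H₁ : ∀ r K (t : ℝ) s, GaugeField (P r K s) (jl r K s) SU2 → (ℬ r K s →L[ℂ] (𝒴 r K s)))
    (hH₁ : ∀ r K t s, ∀ V B, ‖H₁ r K t s V B‖ ≤ B₀ * ‖B‖) (Φ : ∀ r K (t : ℝ) s, GaugeField (P r K s) (jl r K s) SU2 → (Fin (m₀ r K s) → ℂ) → ℬ r K s)
    {rΦ : ℝ} (hΦd : ∀ r K t s, ∀ V, DifferentiableOn ℂ (Φ r K t s V) (ball 0 rΦ)) (hΦ0 : ∀ r K t s, ∀ V, Φ r K t s V 0 = 0)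
    (hΦ : ∀ r K t s, ∀ V, ∀ z ∈ ball (0 : Fin (m₀ r K s) → ℂ) rΦ, ‖Φ r K t s V z‖ < 2 * dL * C₁ * ε₁) (hSr : S < rΦ) (k : Bool → ℕ → σ → ℕ)
    (Sf Sf' Sw Sw' Se Se' : ∀ r K s, Finset (B7Prop1Explicit.Site (P r K s).d × Fin (P r K s).d))
    (Ubg : ∀ r K (t : ℝ) s (τ : ι), GaugeField (P r K s) (jl r K s) SU2 → B7Prop1Explicit.Site (P r K s).d → Fin (P r K s).d → (𝔸 r K s)ˣ)
    (hUbg : ∀ r K t s τ, ∀ V x κ, Ubg r K t s τ V x κ ∈ unitaryUnits (𝔸 r K s)) {α₀ : ℝ} (hα : 0 < α₀) (hα3 : ∀ r K s, C0 (P r K s).d * α₀ ≤ 1 / 3)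
    (hα4 : ∀ r K s, 4 * α₀ ≤ c2' (P r K s).d (P r K s).L) (hα6 : ∀ r K s, 4 * O1cov (P r K s).d * α₀ ≤ 1 / 3)
    (h52locw : ∀ r K t s τ, ∀ V (c : ↥(Sw' r K s)), pdevOn (loK (P r K s).L (k r K s) c.1.1) (bondHiK (P r K s).L (k r K s) c.1.1 c.1.2) (Ubg r K t s
      τ V) < α₀ * ((((P r K s).L : ℝ) ^ k r K s)⁻¹) ^ 2)
    (h52loce : ∀ r K t s τ, ∀ V (c : ↥(Se' r K s)), pdevOn (loK (P r K s).L (k r K s) c.1.1) (bondHiK (P r K s).L (k r K s) c.1.1 c.1.2) (Ubg r K t s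
      τ V) < α₀ * ((((P r K s).L : ℝ) ^ k r K s)⁻¹) ^ 2)
    (ϖe₁ : ∀ r K (t : ℝ) s (τ : ι), ↥(Se r K s) → ℝ) (ϖe₂ : ∀ r K (t : ℝ) s (τ : ι), ↥(Se' r K s) → ℝ) (hϖe₁ : ∀ r K t s τ, ∀ b, 0 ≤ ϖe₁ r K t s τ b)
    (hϖe₂ : ∀ r K t s τ, ∀ c, 0 ≤ ϖe₂ r K t s τ c) {r₀e : ℝ}
    (hreache : ∀ r K t s τ, ∀ (c : ↥(Se' r K s)) (b : ↥(Se r K s)), BondIn (loK (P r K s).L (k r K s) c.1.1) (bondHiK (P r K s).L (k r K s) c.1.1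
      c.1.2) b.1.1 b.1.2 → ϖe₂ r K t s τ c - r₀e ≤ ϖe₁ r K t s τ b)
    (ιs : ∀ r K (t : ℝ) s, GaugeField (P r K s) (jl r K s) SU2 → (𝒴 r K s →L[ℂ] (↥(Sf r K s) → 𝔸 r K s)))
    (hι : ∀ r K t s, ∀ V Y, ‖ιs r K t s V Y‖ ≤ ‖Y‖)
    (Hop : ∀ r K (t : ℝ) s, GaugeField (P r K s) (jl r K s) SU2 → ((↥(Sf' r K s) → 𝔸 r K s) →L[ℂ] (𝒴 r K s)))
    (hH : ∀ r K t s, ∀ V X, ‖Hop r K t s V X‖ ≤ B₀ * ‖X‖) {ε₃ : ℝ} (h18 : ∀ r K s, 18 * C2cov (P r K s).d * B₀ * ε₃ ≤ 1)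
    (hcoup : ε₄ + B₀ * (2 * dL * C₁ * ε₁) ≤ ε₃) (h3R : ∀ r K s, 3 * ε₃ ≤ landauRad (P r K s).d (P r K s).L)
    (ℓs : ∀ r K (t : ℝ) s, ιc r K s → List (𝒴 r K s →L[ℂ] Matrix n n ℂ)) {κr : Bool → ℕ → ℝ} (hκ : ∀ r K s, 0 ≤ κr r (jl r K s))
    (hℓ : ∀ r K t s, ∀ p ∈ Pu r K t s, ∀ ℓ ∈ ℓs r K t s p, ∀ Y, ‖ℓ Y‖ ≤ κr r (jl r K s) * ‖Y‖) {m : ℕ}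
    (hlen : ∀ r K t s, ∀ p ∈ Pu r K t s, (ℓs r K t s p).length ≤ m) {κc : Bool → ℕ → ℝ} (hκc : ∀ r K s, 0 ≤ κc r (jl r K s))
    (hcurl : ∀ r K t s, ∀ p ∈ Pu r K t s, ∀ Y, ‖((ℓs r K t s p).map fun ℓ => ℓ Y).sum‖ ≤ κc r (jl r K s) * ‖Y‖) {Λw Λz Λb 𝔖 : Bool → ℕ → σ → Type*}
    [∀ r K s, Fintype (Λw r K s)] [∀ r K s, DecidableEq (Λw r K s)] [∀ r K s, Fintype (Λz r K s)] [∀ r K s, Fintype (Λb r K s)]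
    {𝔄w ℭ 𝔇 : Bool → ℕ → σ → Type*} [∀ r K s, NormedAddCommGroup (𝔄w r K s)] [∀ r K s, NormedSpace ℂ (𝔄w r K s)] [∀ r K s, CompleteSpace (𝔄w r K s)]
    [∀ r K s, NormedAddCommGroup (ℭ r K s)] [∀ r K s, NormedSpace ℂ (ℭ r K s)] [∀ r K s, NormedAddCommGroup (𝔇 r K s)]
    [∀ r K s, NormedSpace ℂ (𝔇 r K s)] {δw : ℝ} (hδw : 0 ≤ δw) (ϖw : ∀ r K (t : ℝ) s (τ : ι), 𝔖 r K s → ℝ)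
    (dis : ∀ r K (t : ℝ) s (τ : ι), 𝔖 r K s → 𝔖 r K s → ℝ) (hϖw : ∀ r K t s τ, ∀ x y, ϖw r K t s τ x ≤ ϖw r K t s τ y + dis r K t s τ x y)
    (pos : ∀ r K (t : ℝ) s (τ : ι), Λw r K s → 𝔖 r K s) (posz : ∀ r K (t : ℝ) s (τ : ι), Λz r K s → 𝔖 r K s)
    (pos' : ∀ r K (t : ℝ) s (τ : ι), ↥(Sw r K s) → 𝔖 r K s) (posx : ∀ r K (t : ℝ) s (τ : ι), ↥(Sw' r K s) → 𝔖 r K s)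
    (posb : ∀ r K (t : ℝ) s (τ : ι), Λb r K s → 𝔖 r K s)
    (k𝒢 : ∀ r K (t : ℝ) s (τ : ι), GaugeField (P r K s) (jl r K s) SU2 → Λw r K s → Λz r K s → (ℭ r K s →L[ℂ] (𝔄w r K s)))
    (kι : ∀ r K (t : ℝ) s (τ : ι), GaugeField (P r K s) (jl r K s) SU2 → ↥(Sw r K s) → Λw r K s → (𝔄w r K s →L[ℂ] (𝔸 r K s)))
    (kH : ∀ r K (t : ℝ) s (τ : ι), GaugeField (P r K s) (jl r K s) SU2 → Λw r K s → ↥(Sw' r K s) → (𝔸 r K s →L[ℂ] (𝔄w r K s)))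
    (kH₁ : ∀ r K (t : ℝ) s (τ : ι), GaugeField (P r K s) (jl r K s) SU2 → Λw r K s → Λb r K s → (𝔇 r K s →L[ℂ] (𝔄w r K s)))
    {c𝒢 δ𝒢 M𝒢 cι δι Mι cH δH MH cH₁ δH₁ MH₁ : ℝ} (hc𝒢 : 0 ≤ c𝒢) (hM𝒢 : 0 ≤ M𝒢)
    (hk𝒢 : ∀ r K t s τ, ∀ V c b', ‖k𝒢 r K t s τ V c b'‖ ≤ c𝒢 * Real.exp (-(δ𝒢 * dis r K t s τ (pos r K t s τ c) (posz r K t s τ b'))))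
    (hM𝒢' : ∀ r K t s τ, ∀ x, ∑ b', Real.exp (-((δ𝒢 - δw) * dis r K t s τ x (posz r K t s τ b'))) ≤ M𝒢) (hcι : 0 ≤ cι) (hMι : 0 ≤ Mι)
    (hkι : ∀ r K t s τ, ∀ V c b', ‖kι r K t s τ V c b'‖ ≤ cι * Real.exp (-(δι * dis r K t s τ (pos' r K t s τ c) (pos r K t s τ b'))))
    (hMι' : ∀ r K t s τ, ∀ x, ∑ b', Real.exp (-((δι - δw) * dis r K t s τ x (pos r K t s τ b'))) ≤ Mι) (hcH : 0 ≤ cH) (hMH : 0 ≤ MH)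
    (hkH : ∀ r K t s τ, ∀ V c b', ‖kH r K t s τ V c b'‖ ≤ cH * Real.exp (-(δH * dis r K t s τ (pos r K t s τ c) (posx r K t s τ b'))))
    (hMH' : ∀ r K t s τ, ∀ x, ∑ b', Real.exp (-((δH - δw) * dis r K t s τ x (posx r K t s τ b'))) ≤ MH) (hcH₁ : 0 ≤ cH₁) (hMH₁ : 0 ≤ MH₁)
    (hkH₁ : ∀ r K t s τ, ∀ V c b', ‖kH₁ r K t s τ V c b'‖ ≤ cH₁ * Real.exp (-(δH₁ * dis r K t s τ (pos r K t s τ c) (posb r K t s τ b'))))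
    (hMH₁' : ∀ r K t s τ, ∀ x, ∑ b', Real.exp (-((δH₁ - δw) * dis r K t s τ x (posb r K t s τ b'))) ≤ MH₁)
    (W𝒱w : ∀ r K (t : ℝ) s (τ : ι), GaugeField (P r K s) (jl r K s) SU2 → (Λw r K s → 𝔄w r K s) → (Λz r K s → ℭ r K s)) {B₀w C₄w a₃w ε₄w bw : ℝ}
    (h𝒢w : ∀ r K t s τ, ∀ V f, ‖kerOp (k𝒢 r K t s τ V) f‖ ≤ B₀w * ‖f‖) (hWw : ∀ r K t s τ, ∀ V, Prop4Hyp (W𝒱w r K t s τ V) C₄w a₃w) (hB₀w : 0 < B₀w)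
    (hC₄w : 0 ≤ C₄w) (hε₄w : 0 ≤ ε₄w) (hdomw : 2 * (ε₄w + B₀w * bw) ≤ a₃w) (hselfw : B₀w * C₄w * (ε₄w + B₀w * bw) ^ 2 ≤ ε₄w)
    (hcontrw : 4 * B₀w * C₄w * (ε₄w + B₀w * bw) < 1) (hH₁w : ∀ r K t s τ, ∀ V B, ‖kerOp (kH₁ r K t s τ V) B‖ ≤ B₀w * ‖B‖)
    (Φw : ∀ r K (t : ℝ) s (τ : ι), GaugeField (P r K s) (jl r K s) SU2 → (Fin (m₀ r K s) → ℂ) → (Λb r K s → 𝔇 r K s)) {rΦw : ℝ}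
    (hΦdw : ∀ r K t s τ, ∀ V, DifferentiableOn ℂ (Φw r K t s τ V) (ball 0 rΦw)) (hΦ0w : ∀ r K t s τ, ∀ V, Φw r K t s τ V 0 = 0)
    (hΦbw : ∀ r K t s τ, ∀ V, ∀ z ∈ ball (0 : Fin (m₀ r K s) → ℂ) rΦw, ‖Φw r K t s τ V z‖ < bw) (h2Sw : 2 * S ≤ rΦw)
    (hιw : ∀ r K t s τ, ∀ V Y, ‖kerOp (kι r K t s τ V) Y‖ ≤ ‖Y‖) (hHw : ∀ r K t s τ, ∀ V X, ‖kerOp (kH r K t s τ V) X‖ ≤ B₀w * ‖X‖)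
    (hqw : ∀ r K s, 9 * C2cov (P r K s).d * B₀w * (ε₄w + B₀w * bw) < 1) (hRCw : ∀ r K s, 6 * (ε₄w + B₀w * bw) ≤ landauRad (P r K s).d (P r K s).L)
    (NW : ∀ r K (t : ℝ) s (τ : ι), Λz r K s → Λw r K s → Prop)
    (hlocW : ∀ r K t s τ, ∀ V, ∀ A A' : Λw r K s → 𝔄w r K s, ∀ c', (∀ b', NW r K t s τ c' b' → A b' = A' b') → W𝒱w r K t s τ V A c' = W𝒱w r K t s τ V
      A' c')
    {rW : ℝ} (hreachW : ∀ r K t s τ, ∀ c' b', NW r K t s τ c' b' → ϖw r K t s τ (posz r K t s τ c') - rW ≤ ϖw r K t s τ (pos r K t s τ b')) {rC : ℝ}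
    (hreachC : ∀ r K t s τ, ∀ (c' : ↥(Sw' r K s)) (b' : ↥(Sw r K s)), BondIn (loK (P r K s).L (k r K s) c'.1.1) (bondHiK (P r K s).L (k r K s) c'.1.1
      c'.1.2) b'.1.1 b'.1.2 → ϖw r K t s τ (posx r K t s τ c') - rC ≤ ϖw r K t s τ (pos' r K t s τ b'))
    (hsupp : ∀ r K t s τ, ∀ V, ∀ z : Fin (m₀ r K s) → ℂ, ∀ i, 0 < ϖw r K t s τ (posb r K t s τ i) → Φw r K t s τ V z i = 0)
    (hqW : c𝒢 * M𝒢 * (2 * C₄w * a₃w * Real.exp (δw * rW)) < 1)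
    (hk : ∀ r K s, 2 * C2cov (P r K s).d * landauRad (P r K s).d (P r K s).L * Real.exp (δw * rC) * (cι * Mι) * (cH * MH) < 1)
    {𝔭 : Bool → ℕ → σ → Type*} (Pw : ∀ r K (t : ℝ) s (τ : ι), Finset (𝔭 r K s))
    (ℓw : ∀ r K (t : ℝ) s (τ : ι), 𝔭 r K s → List ((Λw r K s → 𝔄w r K s) →L[ℂ] Matrix n n ℂ))
    (suppw : ∀ r K (t : ℝ) s (τ : ι), 𝔭 r K s → Finset (Λw r K s)) (ϖPw : ∀ r K (t : ℝ) s (τ : ι), 𝔭 r K s → ℝ)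
    (hblindw : ∀ r K t s τ, ∀ p ∈ Pw r K t s τ, ∀ ℓ ∈ ℓw r K t s τ p, ∀ A A' : Λw r K s → 𝔄w r K s, (∀ b' ∈ suppw r K t s τ p, A b' = A' b') → ℓ A = ℓ
      A')
    (hdepthw : ∀ r K t s τ, ∀ p ∈ Pw r K t s τ, ∀ b' ∈ suppw r K t s τ p, ϖPw r K t s τ p ≤ ϖw r K t s τ (pos r K t s τ b'))
    (hϖPw : ∀ r K t s τ, ∀ p ∈ Pw r K t s τ, 0 ≤ ϖPw r K t s τ p) {κwb κcb : Bool → ℕ → ℝ} (hκwb : ∀ r K s, 0 ≤ κwb r (jl r K s))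
    (hκcb : ∀ r K s, 0 ≤ κcb r (jl r K s)) (hℓwb : ∀ r K t s τ, ∀ p ∈ Pw r K t s τ, ∀ ℓ ∈ ℓw r K t s τ p, ‖ℓ‖ ≤ κwb r (jl r K s))
    (hcurlw : ∀ r K t s τ, ∀ p ∈ Pw r K t s τ, ‖(ℓw r K t s τ p).sum‖ ≤ κcb r (jl r K s)) {mw : ℕ}
    (hlenw : ∀ r K t s τ, ∀ p ∈ Pw r K t s τ, (ℓw r K t s τ p).length ≤ mw) (𝓡𝒴w : ∀ r K (t : ℝ) s (τ : ι), AddSubgroup (Λw r K s → 𝔄w r K s))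
    (h𝓡𝒴w : ∀ r K t s τ, IsClosed (𝓡𝒴w r K t s τ : Set (Λw r K s → 𝔄w r K s))) (𝓡𝒵w : ∀ r K (t : ℝ) s (τ : ι), AddSubgroup (Λz r K s → ℭ r K s))
    (𝓡ℬw : ∀ r K (t : ℝ) s (τ : ι), AddSubgroup (Λb r K s → 𝔇 r K s))
    (h𝒢rw : ∀ r K t s τ, ∀ V, ∀ f ∈ 𝓡𝒵w r K t s τ, kerOp (k𝒢 r K t s τ V) f ∈ 𝓡𝒴w r K t s τ)
    (hWrw : ∀ r K t s τ, ∀ V, ∀ Y ∈ 𝓡𝒴w r K t s τ, W𝒱w r K t s τ V Y ∈ 𝓡𝒵w r K t s τ)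
    (hιrw : ∀ r K t s τ, ∀ V, ∀ Y ∈ 𝓡𝒴w r K t s τ, kerOp (kι r K t s τ V) Y ∈ skewPi ↥(Sw r K s))
    (hHrw : ∀ r K t s τ, ∀ V, ∀ X ∈ skewPi (𝔸 := 𝔸 r K s) ↥(Sw' r K s), kerOp (kH r K t s τ V) X ∈ 𝓡𝒴w r K t s τ)
    (hH₁rw : ∀ r K t s τ, ∀ V, ∀ B ∈ 𝓡ℬw r K t s τ, kerOp (kH₁ r K t s τ V) B ∈ 𝓡𝒴w r K t s τ)
    (hΦrw : ∀ r K t s τ, ∀ V, ∀ y : Fin (m₀ r K s) → ℝ, ‖y‖ ≤ S → Φw r K t s τ V (cplx y) ∈ 𝓡ℬw r K t s τ)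
    (hskew : ∀ r K t s τ, ∀ p ∈ Pw r K t s τ, ∀ ℓ ∈ ℓw r K t s τ p, ∀ Y ∈ 𝓡𝒴w r K t s τ, ℓ Y ∈ skewAdjoint (Matrix n n ℂ))
    (Bp : ∀ r K (t : ℝ) s (τ : ι), GaugeField (P r K s) (jl r K s) SU2 → 𝔭 r K s → Matrix n n ℂ) {d : ∀ r K (t : ℝ) s (τ : ι), 𝔭 r K s → ℝ}
    {dbar : Bool → ℕ → ℝ} (hBu : ∀ r K t s τ, ∀ V, ∀ p ∈ Pw r K t s τ, Bp r K t s τ V p ∈ unitary (Matrix n n ℂ))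
    (hBd : ∀ r K t s τ, ∀ V, ∀ p ∈ Pw r K t s τ, ‖Bp r K t s τ V p - 1‖ ≤ d r K t s τ p)
    (hd : ∀ r K t s τ, ∀ p ∈ Pw r K t s τ, d r K t s τ p ≤ dbar r (jl r K s)) (hdbar : ∀ r K s, 0 ≤ dbar r (jl r K s)) {Kw : Bool → ℕ → ℝ}
    (hKw : ∀ r K t s τ, ∑ p ∈ Pw r K t s τ, Real.exp (-(δw * ϖPw r K t s τ p)) ≤ Kw r (jl r K s)) {Λe : Bool → ℕ → σ → Type*}
    [∀ r K s, Fintype (Λe r K s)] {𝔄 : Bool → ℕ → σ → Type*} [∀ r K s, NormedAddCommGroup (𝔄 r K s)] [∀ r K s, NormedSpace ℂ (𝔄 r K s)]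
    [∀ r K s, CompleteSpace (𝔄 r K s)] {δ' : ℝ} {ϖ : ∀ r K (t : ℝ) s (τ : ι), Λe r K s → ℝ} (hδ' : 0 ≤ δ')
    (hϖ : ∀ r K t s τ, ∀ b', 0 ≤ ϖ r K t s τ b') {𝒵e ℬe : Bool → ℕ → σ → Type*} [∀ r K s, NormedAddCommGroup (𝒵e r K s)]
    [∀ r K s, NormedSpace ℂ (𝒵e r K s)] [∀ r K s, NormedAddCommGroup (ℬe r K s)] [∀ r K s, NormedSpace ℂ (ℬe r K s)]
    (𝒢e : ∀ r K t s (τ : ι), GaugeField (P r K s) (jl r K s) SU2 → (𝒵e r K s →L[ℂ] WSup (pinW δ' (ϖ r K t s τ)) 1 (𝔄 r K s)))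
    (W𝒱e : ∀ r K t s (τ : ι), GaugeField (P r K s) (jl r K s) SU2 → WSup (pinW δ' (ϖ r K t s τ)) 1 (𝔄 r K s) → 𝒵e r K s) {B₀e C₄e a₃e be ε₄e : ℝ}
    (h𝒢e : ∀ r K t s τ, ∀ V f, ‖𝒢e r K t s τ V f‖ ≤ B₀e * ‖f‖) (hWe : ∀ r K t s τ, ∀ V, Prop4Hyp (W𝒱e r K t s τ V) C₄e a₃e) (hB₀e : 0 < B₀e)
    (hC₄e : 0 ≤ C₄e) (hbe : 0 ≤ be) (hε₄e : 0 ≤ ε₄e) (hdome : 2 * (ε₄e + B₀e * be) ≤ a₃e) (hselfe : B₀e * C₄e * (ε₄e + B₀e * be) ^ 2 ≤ ε₄e)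
    (hcontre : 4 * B₀e * C₄e * (ε₄e + B₀e * be) < 1)
    (H₁e : ∀ r K t s (τ : ι), GaugeField (P r K s) (jl r K s) SU2 → (ℬe r K s →L[ℂ] WSup (pinW δ' (ϖ r K t s τ)) 1 (𝔄 r K s)))
    (hH₁e : ∀ r K t s τ, ∀ V B, ‖H₁e r K t s τ V B‖ ≤ B₀e * ‖B‖)
    (Φe : ∀ r K (t : ℝ) s (τ : ι), GaugeField (P r K s) (jl r K s) SU2 → (Fin (m₀ r K s) → ℂ) → ℬe r K s) {rΦe : ℝ}
    (hΦde : ∀ r K t s τ, ∀ V, DifferentiableOn ℂ (Φe r K t s τ V) (ball 0 rΦe)) (hΦ0e : ∀ r K t s τ, ∀ V, Φe r K t s τ V 0 = 0)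
    (hΦbe : ∀ r K t s τ, ∀ V, ∀ z ∈ ball (0 : Fin (m₀ r K s) → ℂ) rΦe, ‖Φe r K t s τ V z‖ < be) (hSre : S < rΦe)
    (ιe : ∀ r K t s (τ : ι), GaugeField (P r K s) (jl r K s) SU2 → (WSup (pinW δ' (ϖ r K t s τ)) 1 (𝔄 r K s) →L[ℂ] WSup (pinW δ' (ϖe₁ r K t s τ)) 1 (𝔸
      r K s)))
    (hιe : ∀ r K t s τ, ∀ V Y, ‖ιe r K t s τ V Y‖ ≤ ‖Y‖)
    (He : ∀ r K t s (τ : ι), GaugeField (P r K s) (jl r K s) SU2 → (WSup (pinW δ' (ϖe₂ r K t s τ)) 1 (𝔸 r K s) →L[ℂ] WSup (pinW δ' (ϖ r K t s τ)) 1 (𝔄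
      r K s)))
    (hHe : ∀ r K t s τ, ∀ V X, ‖He r K t s τ V X‖ ≤ B₀e * ‖X‖)
    (hqe : ∀ r K s, 9 * (C2cov (P r K s).d * Real.exp (2 * δ' * r₀e)) * B₀e * (ε₄e + B₀e * be) < 1)
    (hRCe : ∀ r K s, 3 * (ε₄e + B₀e * be) ≤ landauRad (P r K s).d (P r K s).L) {𝔱 : Bool → ℕ → σ → Type*}
    (I : ∀ r K (t : ℝ) s (τ : ι), Finset (𝔱 r K s)) {Ef : ∀ r K (t : ℝ) s (τ : ι), 𝔱 r K s → (Λe r K s → 𝔄 r K s) → ℂ} {rE : ℝ}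
    {ee : ∀ r K (t : ℝ) s (τ : ι), 𝔱 r K s → ℝ} (hrE : 0 < rE) (hEd : ∀ r K t s τ, ∀ i ∈ I r K t s τ, DifferentiableOn ℂ (Ef r K t s τ i) (ball 0 rE))
    (hEb : ∀ r K t s τ, ∀ i ∈ I r K t s τ, ∀ Z ∈ ball (0 : Λe r K s → 𝔄 r K s) rE, ‖Ef r K t s τ i Z‖ ≤ ee r K t s τ i)
    (he0 : ∀ r K t s τ, ∀ i ∈ I r K t s τ, 0 ≤ ee r K t s τ i) (supp : ∀ r K (t : ℝ) s (τ : ι), 𝔱 r K s → Finset (Λe r K s))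
    (hblind : ∀ r K t s τ, ∀ i ∈ I r K t s τ, ∀ A₁ A₂ : Λe r K s → 𝔄 r K s, (∀ b' ∈ supp r K t s τ i, A₁ b' = A₂ b') → Ef r K t s τ i A₁ = Ef r K t s
      τ i A₂)
    (ϖP : ∀ r K (t : ℝ) s (τ : ι), 𝔱 r K s → ℝ) (hdepth : ∀ r K t s τ, ∀ i ∈ I r K t s τ, ∀ b' ∈ supp r K t s τ i, ϖP r K t s τ i ≤ ϖ r K t s τ b')
    {LK : ℝ} (hLK : 0 ≤ LK) (hK : ∀ r K t s τ, ∑ i ∈ I r K t s τ, 2 * ee r K t s τ i / rE * Real.exp (-(δ' * ϖP r K t s τ i)) ≤ LK)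
    (hcoupE : ∀ r K s, ((ε₄e + B₀e * be) + B₀e * (4 * (C2cov (P r K s).d * Real.exp (2 * δ' * r₀e)) * (ε₄e + B₀e * be) ^ 2)) ≤ rE / 2) {BE₁ : ℝ}
    (hElb₁ : ∀ r K t s τ, ∀ V (y : Fin (m₀ r K s) → ℝ), ‖y‖ ≤ S → -BE₁ ≤ (∑ i ∈ I r K t s τ, Ef r K t s τ i (WSup.toPiL (𝔄 := 𝔄 r K s) (pinW δ' (ϖ r K
      t s τ)) 1 (landauExp (fun Y : WSup (pinW δ' (ϖe₁ r K t s τ)) 1 (𝔸 r K s) => ((toPiL (pinW δ' (ϖe₂ r K t s τ)) 1).symm (landauCf (P r K s).L (Ubg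
      r K t s τ V) (k r K s) (Se r K s) (Se' r K s) (toPiL (pinW δ' (ϖe₁ r K t s τ)) 1 Y)) : WSup (pinW δ' (ϖe₂ r K t s τ)) 1 (𝔸 r K s))) (ιe r K t s
      τ V) (He r K t s τ V) (4 * (C2cov (P r K s).d * Real.exp (2 * δ' * r₀e)) * (ε₄e + B₀e * be) ^ 2) (solAt (𝒢e r K t s τ V) 0 (W𝒱e r K t s τ V) ε₄e
      (0 : 𝒵e r K s) (H₁e r K t s τ V (Φe r K t s τ V (cplx y))) + H₁e r K t s τ V (Φe r K t s τ V (cplx y)))))).re)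
    {Ω : Bool → ℕ → σ → Type*} [∀ r K s, MeasurableSpace (Ω r K s)] (μ : ∀ r K (t : ℝ) s (τ : ι), Measure (Ω r K s))
    {g : ∀ r K (t : ℝ) s (τ : ι), Ω r K s → ℝ} (hg : ∀ r K t s τ, ∀ ω, 0 ≤ g r K t s τ ω)
    (Aex : ∀ r K (t : ℝ) s (τ : ι), GaugeField (P r K s) (jl r K s) SU2 → (Fin (m₀ r K s) → ℝ) → Ω r K s → ℝ) {Bd : ℝ} (hBd0 : 0 ≤ Bd)
    (hint : ∀ r K t s τ, ∀ V, ∀ x ∈ W r K t s τ V, ∀ c : ℝ, 1 / 2 ≤ c → c ≤ 1 → Integrable (fun ω => g r K t s τ ω * Real.exp (Aex r K t s τ V (c • x)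
      ω)) (μ r K t s τ))
    (hpos : ∀ r K t s τ, ∀ V, ∀ x ∈ W r K t s τ V, ∀ c : ℝ, 1 / 2 ≤ c → c ≤ 1 → 0 < ∫ ω, g r K t s τ ω * Real.exp (Aex r K t s τ V (c • x) ω) ∂(μ r K
      t s τ))
    (hA : ∀ r K t s τ, ∀ V, ∀ x ∈ W r K t s τ V, ∀ c : ℝ, 1 / 2 ≤ c → c ≤ 1 → ∀ ω, Aex r K t s τ V x ω ≤ Aex r K t s τ V (c • x) ω + (1 - c) * Bd)
    {BE₂ : ℝ}
    (hElb₂ : ∀ r K t s τ, ∀ V (y : Fin (m₀ r K s) → ℝ), ‖y‖ ≤ S → -BE₂ ≤ (-Real.log (∫ ω, g r K t s τ ω * Real.exp (Aex r K t s τ V y ω) ∂(μ r K t s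
      τ))))
    (L : ∀ r K (t : ℝ) s, Set (𝒴 r K s →L[ℂ] Matrix n n ℂ)) (𝓡𝒵 : ∀ r K (t : ℝ) s, AddSubgroup (𝒵 r K s))
    (𝓡ℬ : ∀ r K (t : ℝ) s, AddSubgroup (ℬ r K s)) (h𝒢r : ∀ r K t s, ∀ V, ∀ f ∈ 𝓡𝒵 r K t s, 𝒢 r K t s V f ∈ readOutReal (L r K t s))
    (hWr : ∀ r K t s, ∀ V, ∀ Y ∈ readOutReal (L r K t s), W𝒱 r K t s V Y ∈ 𝓡𝒵 r K t s)
    (hιr : ∀ r K t s, ∀ V, ∀ Y ∈ readOutReal (L r K t s), ιs r K t s V Y ∈ skewPi ↥(Sf r K s))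
    (hHr : ∀ r K t s, ∀ V, ∀ X ∈ skewPi (𝔸 := 𝔸 r K s) ↥(Sf' r K s), Hop r K t s V X ∈ readOutReal (L r K t s))
    (hH₁r : ∀ r K t s, ∀ V, ∀ B ∈ 𝓡ℬ r K t s, H₁ r K t s V B ∈ readOutReal (L r K t s))
    (hΦr : ∀ r K t s, ∀ V, ∀ y : Fin (m₀ r K s) → ℝ, ‖y‖ ≤ S → Φ r K t s V (cplx y) ∈ 𝓡ℬ r K t s)
    (hRdict : ∀ r K t s τ, ∀ V, ∀ x ∈ cube (m₀ r K s) S, F r K t s τ (fixTo (combBonds (lo r K s) (hi r K s)) 1 (updateFinset V (Λ r K s)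
      (expFibreChart (Λ r K s) 1 (e r K s) x))) = Jco r K t s τ V x * ENNReal.ofReal (Real.exp (-((∑ p ∈ Pw r K t s τ, β r (jl r K s) * (1 -
      (Matrix.trace (Bp r K t s τ V p * holOf (ℓw r K t s τ p) (fun y => landauExp (landauCfBox (P r K s).L (Ubg r K t s τ V) (k r K s) (Sw r K s)
      (Sw' r K s) (landauRad (P r K s).d (P r K s).L)) (kerOp (kι r K t s τ V)) (kerOp (kH r K t s τ V)) (4 * C2cov (P r K s).d * (ε₄w + B₀w * bw) ^
      2) (solAt (kerOp (k𝒢 r K t s τ V)) 0 (W𝒱w r K t s τ V) ε₄w (0 : Λz r K s → ℭ r K s) (kerOp (kH₁ r K t s τ V) (Φw r K t s τ V (cplx y))) + kerOp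
      (kH₁ r K t s τ V) (Φw r K t s τ V (cplx y)))) x)).re / Fintype.card n)) + ((∑ i ∈ I r K t s τ, Ef r K t s τ i (WSup.toPiL (𝔄 := 𝔄 r K s) (pinW
      δ' (ϖ r K t s τ)) 1 (landauExp (fun Y : WSup (pinW δ' (ϖe₁ r K t s τ)) 1 (𝔸 r K s) => ((toPiL (pinW δ' (ϖe₂ r K t s τ)) 1).symm (landauCf (P r K
      s).L (Ubg r K t s τ V) (k r K s) (Se r K s) (Se' r K s) (toPiL (pinW δ' (ϖe₁ r K t s τ)) 1 Y)) : WSup (pinW δ' (ϖe₂ r K t s τ)) 1 (𝔸 r K s)))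
      (ιe r K t s τ V) (He r K t s τ V) (4 * (C2cov (P r K s).d * Real.exp (2 * δ' * r₀e)) * (ε₄e + B₀e * be) ^ 2) (solAt (𝒢e r K t s τ V) 0 (W𝒱e r K
      t s τ V) ε₄e (0 : 𝒵e r K s) (H₁e r K t s τ V (Φe r K t s τ V (cplx x))) + H₁e r K t s τ V (Φe r K t s τ V (cplx x)))))).re + (-Real.log (∫ ω, g
      r K t s τ ω * Real.exp (Aex r K t s τ V x ω) ∂(μ r K t s τ))))))))
    (hudict : ∀ r K t s, ∀ V, ∀ x ∈ cube (m₀ r K s) S, u r K t s (fixTo (combBonds (lo r K s) (hi r K s)) 1 (updateFinset V (Λ r K s) (expFibreChart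
      (Λ r K s) 1 (e r K s) x))) = classifier (hPu r K t s) (fun p => holOf (ℓs r K t s p) (fun y => landauExp ((ball (0 : ↥(Sf r K s) → 𝔸 r K s)
      (landauRad (P r K s).d (P r K s).L)).indicator (landauCf (P r K s).L (1 : B7Prop1Explicit.Site (P r K s).d → Fin (P r K s).d → (𝔸 r K s)ˣ) (k r
      K s) (Sf r K s) (Sf' r K s))) (ιs r K t s V) (Hop r K t s V) (4 * C2cov (P r K s).d * (ε₄ + B₀ * (2 * dL * C₁ * ε₁)) ^ 2) (solAt (𝒢 r K t s V) 0
      (W𝒱 r K t s V) ε₄ (0 : 𝒵 r K s) (H₁ r K t s V (Φ r K t s V (cplx y))) + H₁ r K t s V (Φ r K t s V (cplx y))))) x)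
    (hJW : ∀ r K t s τ, ∀ V x, Jco r K t s τ V x ≠ 0 → x ∈ W r K t s τ V)
    (hJ : ∀ r K t s τ, ∀ V x, ∀ a : ℝ, 0 ≤ a → Jco r K t s τ V x ≤ Jco r K t s τ V (Real.exp (-a) • x))
    (hJ1 : ∀ r K t s τ, ∀ V x, Jco r K t s τ V x ≤ 1) (hWS : ∀ r K t s τ, ∀ V, W r K t s τ V ⊆ closedBall (0 : Fin (m₀ r K s) → ℝ) S) (hδ0 : 0 ≤ δ)
    (hδ1 : δ < 1) {c₁ c₂ zs : ℝ}
    (hs₁ : ∀ r K s, κc r (jl r K s) * ((ε₄ + B₀ * (2 * dL * C₁ * ε₁)) + B₀ * (4 * C2cov (P r K s).d * (ε₄ + B₀ * (2 * dL * C₁ * ε₁)) ^ 2)) ≤ c₁ * η r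
      (jl r K s) ^ 2 * zs)
    (ha : ∀ r K s, κr r (jl r K s) * ((ε₄ + B₀ * (2 * dL * C₁ * ε₁)) + B₀ * (4 * C2cov (P r K s).d * (ε₄ + B₀ * (2 * dL * C₁ * ε₁)) ^ 2)) ≤ c₂ * η r
      (jl r K s) * zs)
    (hma : ∀ r K s, m * (κr r (jl r K s) * ((ε₄ + B₀ * (2 * dL * C₁ * ε₁)) + B₀ * (4 * C2cov (P r K s).d * (ε₄ + B₀ * (2 * dL * C₁ * ε₁)) ^ 2))) ≤ 1)
    (hsm : ∀ (K : ℕ) (s : σ), 36 * (c₁ * zs + m ^ 2 * c₂ ^ 2 * zs ^ 2) / (rΦ / S - 1) ^ 2 ≤ δ * ε (K - lvl K s)) {a : ℝ} (ha0 : 0 ≤ a)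
    (hrad : ∀ r K s, (((P r K s).d - 1 : ℕ) : ℝ) * nb r K s * a ≤ 2 * Real.sin (S / 2)) {Pcore : ∀ r K (t : ℝ) s, Set (Plaq (P r K s) (jl r K s))}
    {Pcollar : ∀ r K (t : ℝ) s (τ : ι), Set (Plaq (P r K s) (jl r K s))}
    (hcover : ∀ r K t s τ, boxPlaqs (lo r K s) (hi r K s) ⊆ Pcore r K t s ∪ (Pcollar r K t s τ))
    (hcore : ∀ r K t s, ∀ (V : GaugeField (P r K s) (jl r K s) SU2) (y : ↥(Λ r K s) → SU2), u r K t s (fixTo (combBonds (lo r K s) (hi r K s)) 1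
      (updateFinset V (Λ r K s) y)) < ε (K - lvl K s) * η r (jl r K s) ^ 2 → PlaqSmallOn (Pcore r K t s) a (fixTo (combBonds (lo r K s) (hi r K s)) 1
      (updateFinset V (Λ r K s) y)))
    (hcollar : ∀ r K t s τ, ∀ (V : GaugeField (P r K s) (jl r K s) SU2) (y : ↥(Λ r K s) → SU2), F r K t s τ (fixTo (combBonds (lo r K s) (hi r K s)) 1
      (updateFinset V (Λ r K s) y)) ≠ 0 → PlaqSmallOn (Pcollar r K t s τ) a (fixTo (combBonds (lo r K s) (hi r K s)) 1 (updateFinset V (Λ r K s) y)))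
    (hβ : ∀ r j, 0 ≤ β r j)
    -- END-II's width is END-I's `geomWidth` (S99 f3b's number rows `hρ0`∕`hρ` DISCHARGED ∕ DISPLAYED as ONE inequality)
    (hρg : ∀ j, geomWidth Cr θmin ϑ j ≤ (1 - δ) / 2)
    (hread : ∀ r K t, |t| ≤ l₀ → ∀ s ∈ C K, v r K t s = u r K t s ∘ π r K s)
    (hid : ∀ r K t, |t| ≤ l₀ → ∀ s ∈ C K, ∀ τ ∈ T K, s ∈ small K τ → (histLaw (ν r K t τ) (small K τ) (v r K t) (fun s' => ε (K - lvl K s') * η r (jl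
      r K s') ^ 2)).map (π r K s) = (fieldMeasure (P r K s) (jl r K s) SU2).withDensity ({U | u r K t s U < ε (K - lvl K s) * η r (jl r K s) ^
      2}.indicator (F r K t s τ)))
    -- the slot → level majorant: S99 f3b's slot constant under the run's level profile `D r`, on the live slots
    (hDslot : ∀ r K t, |t| ≤ l₀ → ∀ s ∈ C K, 2 * ((m₀ r K s : ℝ) + (3 * (|β r (jl r K s)| * ((dbar r (jl r K s) + 2 * (κcb r (jl r K s) * (cH₁ * MH₁ *
      bw / ((1 - c𝒢 * M𝒢 * (2 * C₄w * a₃w * Real.exp (δw * rW))) * (1 - 2 * C2cov (P r K s).d * landauRad (P r K s).d (P r K s).L * Real.exp (δw * rC)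
      * (cι * Mι) * (cH * MH)))) + expTail₂ (mw * (κwb r (jl r K s) * (cH₁ * MH₁ * bw / ((1 - c𝒢 * M𝒢 * (2 * C₄w * a₃w * Real.exp (δw * rW))) * (1 - 2
      * C2cov (P r K s).d * landauRad (P r K s).d (P r K s).L * Real.exp (δw * rC) * (cι * Mι) * (cH * MH))))))) / (rΦw / S)) * (2 * (κcb r (jl r K s)
      * (cH₁ * MH₁ * bw / ((1 - c𝒢 * M𝒢 * (2 * C₄w * a₃w * Real.exp (δw * rW))) * (1 - 2 * C2cov (P r K s).d * landauRad (P r K s).d (P r K s).L *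
      Real.exp (δw * rC) * (cι * Mι) * (cH * MH)))) + expTail₂ (mw * (κwb r (jl r K s) * (cH₁ * MH₁ * bw / ((1 - c𝒢 * M𝒢 * (2 * C₄w * a₃w * Real.exp
      (δw * rW))) * (1 - 2 * C2cov (P r K s).d * landauRad (P r K s).d (P r K s).L * Real.exp (δw * rC) * (cι * Mι) * (cH * MH))))))) / (rΦw / S))) *
      Kw r (jl r K s)) + (3 * (LK * (2 * ((ε₄e + B₀e * be) + B₀e * (4 * (C2cov (P r K s).d * Real.exp (2 * δ' * r₀e)) * (ε₄e + B₀e * be) ^ 2)))) /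
      (rΦe / S - 1) + Bd))) / (1 - δ) ≤ D r (lvl K s)) :
    ShellWeightBound l₀ T
      (fun K t τ => histWeight (ν true K t τ) (small K τ) (v true K t) (fun s => ε (K - lvl K s) * η true (jl true K s) ^ 2))
      (fun K t τ => histWeight (ν false K t τ) (small K τ) (v false K t) (fun s => ε (K - lvl K s) * η false (jl false K s) ^ 2))
      (fun K t τ => histShell (ν true K t τ) (small K τ) (fun s ω => v true K t s ω / η true (jl true K s) ^ 2)
        (fun s ω => v false K t s ω / η false (jl false K s) ^ 2) (fun s => ε (K - lvl K s)))
      (fun K t τ => histShell (ν false K t τ) (small K τ) (fun s ω => v false K t s ω / η false (jl false K s) ^ 2)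
        (fun s ω => v true K t s ω / η true (jl true K s) ^ 2) (fun s => ε (K - lvl K s)))
      (fun K => ∑ s ∈ C K, D true (lvl K s) * geomWidth Cr θmin ϑ (lvl K s) +
        ∑ s ∈ C K, D false (lvl K s) * geomWidth Cr θmin ϑ (lvl K s)) := by
  -- file 1‴: END-II (S99 f3b) ∘ S90 per `(r, K, t, s, τ)` at `lvl := lvl`, `ε := ε`, `ρ := geomWidth Cr θmin ϑ` (threshold units)
  have hlive := hac_live_of_assembled_decay_histories_cfB7 P jl (fun _ => lvl) (ε := fun _ => ε) (ρ := fun _ j => geomWidth Cr θmin ϑ j) hη (fun _ a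
    => hε a) (fun _ j => geomWidth_nonneg hCr hmin.le hϑ0.le j) hn hN Λ hΛbox hΛcomb e hS hSπ hF hFi hu hui hPu W Jco 𝒢 W𝒱 h𝒢 hW hB₀ hC₄ hε₄ hdL hC₁
    hε₁ hB₃ h1 h2 h3 H₁ hH₁ Φ hΦd hΦ0 hΦ hSr k Sf Sf' Sw Sw' Se Se' Ubg hUbg hα hα3 hα4 hα6 h52locw h52loce ϖe₁ ϖe₂ hϖe₁ hϖe₂ hreache ιs hι Hop hH h18
    hcoup h3R ℓs hκ hℓ hlen hκc hcurl hδw ϖw dis hϖw pos posz pos' posx posb k𝒢 kι kH kH₁ hc𝒢 hM𝒢 hk𝒢 hM𝒢' hcι hMι hkι hMι' hcH hMH hkH hMH' hcH₁ hMH₁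
    hkH₁ hMH₁' W𝒱w h𝒢w hWw hB₀w hC₄w hε₄w hdomw hselfw hcontrw hH₁w Φw hΦdw hΦ0w hΦbw h2Sw hιw hHw hqw hRCw NW hlocW hreachW hreachC hsupp hqW hk Pw
    ℓw suppw ϖPw hblindw hdepthw hϖPw hκwb hκcb hℓwb hcurlw hlenw 𝓡𝒴w h𝓡𝒴w 𝓡𝒵w 𝓡ℬw h𝒢rw hWrw hιrw hHrw hH₁rw hΦrw hskew Bp hBu hBd hd hdbar hKw hδ' hϖ
    𝒢e W𝒱e h𝒢e hWe hB₀e hC₄e hbe hε₄e hdome hselfe hcontre H₁e hH₁e Φe hΦde hΦ0e hΦbe hSre ιe hιe He hHe hqe hRCe I hrE hEd hEb he0 supp hblind ϖP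
    hdepth hLK hK hcoupE hElb₁ μ hg Aex hBd0 hint hpos hA hElb₂ L 𝓡𝒵 𝓡ℬ h𝒢r hWr hιr hHr hH₁r hΦr hRdict hudict hJW hJ hJ1 hWS hδ0 hδ1 hs₁ ha hma (fun
    _ K s => hsm K s) ha0 hrad hcover hcore hcollar (fun _ j => hρg j) hβ
  -- RAW (fine) currency on the slot's layer (S90 `slotAntiConcentration_fine_iff`), at the level constant, per live-small history
  have hlay : ∀ (r : Bool) (K : ℕ) (t : ℝ), |t| ≤ l₀ → ∀ s ∈ C K, ∀ τ ∈ T K, s ∈ small K τ →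
      SlotAntiConcentration ((fieldMeasure (P r K s) (jl r K s) SU2).withDensity
        ({U | u r K t s U < ε (K - lvl K s) * η r (jl r K s) ^ 2}.indicator (F r K t s τ))) (u r K t s)
        (ε (K - lvl K s) * η r (jl r K s) ^ 2) (geomWidth Cr θmin ϑ (lvl K s)) (D r (lvl K s)) :=
    fun r K t ht s hs τ _ _ =>
      slotAntiConcentration_mono (geomWidth_nonneg hCr hmin.le hϑ0.le _) (hDslot r K t ht s hs)
        ((slotAntiConcentration_fine_iff (hη r (jl r K s))).2 (hlive r K t s τ))
  -- S103a §3c: transport to the `s`-small partial law with the FINE profile (per run, `ηr K s := η r (jl r K s)`)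
  have hac : ∀ r : Bool, ∀ K t, |t| ≤ l₀ → ∀ s ∈ C K,
      SlotAntiConcentration
        (partialLaw (T K) (ν r K t) (small K) (v r K t) (fun s' => ε (K - lvl K s') * η r (jl r K s') ^ 2) s) (v r K t s)
        (ε (K - lvl K s) * η r (jl r K s) ^ 2) (geomWidth Cr θmin ϑ (lvl K s)) (D r (lvl K s)) := fun r =>
    hac_histories_fine_of_layers (ηr := fun K s => η r (jl r K s)) (Lay := fun K s => GaugeField (P r K s) (jl r K s) SU2)
      (π := π r) (hπ r) (u' := fun K t s => u r K t s) (hread r)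
      (fun K t s τ => (fieldMeasure (P r K s) (jl r K s) SU2).withDensity
        ({U | u r K t s U < ε (K - lvl K s) * η r (jl r K s) ^ 2}.indicator (F r K t s τ))) (hid r) (hlay r)
  -- S93 §3: the histories-road END-I OF RECORD with `LocalRate` BY NAME
  exact shellWeightBound_histories_fine_of_localRate (ηA := fun K s => η true (jl true K s))
    (ηB := fun K s => η false (jl false K s)) (hv true) (hv false) (fun K s => hη true _) (fun K s => hη false _) hsmall hloc
    hCr hmin hfloor hRA hRB (hD0 true) (hD0 false) (hac true) (hac false) hw hϑ0 hϑ1 (hDbar true) (hDbar false)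

end Summit.QuantumFields.BalabanUV.T4Continuum.ShellMeasureLiveEndOneCallHistoriesFine

end
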